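import Mathlib
import Summits.NavierStokesRegularity.NavierStokesRegularity.Theorems.FrozenSignCascadeEnvelopeBoundEnstrophy
import Summits.NavierStokesRegularity.NavierStokesRegularity.Theorems.FrozenSignCascadeEnvelopeBoundEnergyIdentity
import Summits.NavierStokesRegularity.NavierStokesRegularity.Theorems.FrozenSignCascadeEnvelopeBoundLerayDecay
import HarnessLib

/-!
# Route FrozenSignCascade · crux `EnvelopeBound` (stmt-NavierStokesRegularity-1549): the Leray-horizon
  normalisation of the crux and the Leray-class regime

Support file for the crux item stmt-NavierStokesRegularity-1549 (`EnvelopeBound`, route `FrozenSignCascade`,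
line `registered`, reshape r3, lead c3); lands `--supports` that item. It is the CLOSED TWIN of the r3
skeleton `Cruxes/EnvelopeBound/Lines/birth.lean`: the composition with the one open stub as a hypothesis.

* `envelopeBound_of_farFromLeray`: **REDUCTION.** `EnvelopeBound` follows from "far-from-Leray control": for
  every `ν, u₀` and enstrophy threshold `ω > 0` a bound of the critical envelope along every Fourier-mild solution
  from the datum at the times `t ≤ E₀/(2cω)` up to which the Fourier enstrophy has stayed `≥ ω`. Proof = the
  skeleton's: Leray's lemma (`Leray.leray_threshold`) fixes `ω = θc⁴/(E₀+1)`; the first time `r₀ ≤ t` with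
  `Ens ≤ ω` is an infimum (continuity of `Ens`), its envelope is controlled by the hypothesis (or it is the
  datum), and from `r₀` on the enstrophy stays `≤ ω`, so energy × enstrophy bounds the envelope
  (`Registered.envelope_le_of_enstrophy`); the horizon `t ≤ E₀/(2cω)` is `Leray.far_horizon` (energy identity).
* `farFromLeray_of_envelopeBound`, `envelopeBound_iff_farFromLeray`: the converse is trivial, so the open stub
  of r3 is EQUIVALENT to the crux — the crux is a statement about the bounded Leray window `[0, E₀/(2cω)]`
  ("no overshoot of the critical envelope while the flow is outside Leray's absorbing ball").
* `envelope_lerayClass`: **NEW PROVABLE REGIME** — Leray-small data (`E₀·Ens₀ ≤ θ(4π²ν)⁴`, the scale-invariant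
  smallness `‖u₀‖₂‖∇u₀‖₂ ≲ ν²` of Leray 1934) satisfy the conclusion of the crux at every horizon with a
  horizon-free constant (complements the small-`PM²` regime `Registered.envelopeBound_smallData`, p150705).

References: J. Leray, Acta Math. 63 (1934) §§22–23; P. G. Lemarié-Rieusset (2016), Thm. 7.3, §8.5.
-/

noncomputable section

set_option linter.dupNamespace false -- nested layout Summit.<S>.<Sub>, Sub = S (D-0017)

open Set MeasureTheory Filter Topology Real
open Literature.Analysis.FluidPDE Literature.Analysis.FluidPDE.FourierNS
open Summit.NavierStokesRegularity.NavierStokesRegularity.Theorems.EnvelopeBound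

namespace Summit.NavierStokesRegularity.NavierStokesRegularity.Theorems.EnvelopeBound.Leray

/-- **REDUCTION: the crux from far-from-Leray control (closed twin of the r3 skeleton composition).** -/
theorem envelopeBound_of_farFromLeray :
    (∀ ν : ℝ, 0 < ν →
      ∀ (u₀ : EuclideanSpace ℝ (Fin 3) → EuclideanSpace ℝ (Fin 3)) (hu : ContDiff ℝ (⊤ : ℕ∞) u₀)
        (hd : Literature.Analysis.FluidPDE.HasRapidSpatialDecay u₀),
        Literature.Analysis.FluidPDE.NSWave0.IsDivFree u₀ →
      ∀ ω : ℝ, 0 < ω → ∃ C : ℝ, ∀ T : ℝ, ∀ V : ℝ → EuclideanSpace ℝ (Fin 3) → Fin 3 → ℂ,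
        Literature.Analysis.FluidPDE.FourierNS.IsFourierMild (4 * Real.pi ^ 2 * ν) 4 0 T V →
        V 0 = Literature.Analysis.FluidPDE.FourierNS.fourierData hu hd →
        ∀ t ∈ Set.Icc 0 T,
          t ≤ (∫ ξ, ∑ l, ‖Literature.Analysis.FluidPDE.FourierNS.fourierData hu hd ξ l‖ ^ 2) /
            (2 * (4 * Real.pi ^ 2 * ν) * ω) →
          (∀ r ∈ Set.Icc 0 t, ω ≤ ∫ ξ, ‖ξ‖ ^ 2 * ∑ l, ‖V r ξ l‖ ^ 2) →
          ∀ ξ : EuclideanSpace ℝ (Fin 3), ‖ξ‖ ^ 2 * ‖V t ξ‖ ≤ C) →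
    Summit.NavierStokesRegularity.NavierStokesRegularity.Theses.FrozenSignCascade.EnvelopeBound := by
  intro hfarStub ν hν u₀ hu hd hdiv T₀ hT₀
  obtain ⟨θ, hθ, hler⟩ := leray_threshold
  set c : ℝ := 4 * Real.pi ^ 2 * ν with hc
  have hcpos : 0 < c := by positivity
  set a : EuclideanSpace ℝ (Fin 3) → Fin 3 → ℂ := fourierData hu hd with ha
  set E₀ : ℝ := ∫ ξ, ∑ l, ‖a ξ l‖ ^ 2 with hE₀
  have hE₀0 : 0 ≤ E₀ := integral_nonneg fun ξ => Finset.sum_nonneg fun l _ => sq_nonneg _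
  set ω : ℝ := θ * c ^ 4 / (E₀ + 1) with hω
  have hωpos : 0 < ω := by positivity
  have hE₀ω : E₀ * ω ≤ θ * c ^ 4 := by
    rw [hω, mul_div_assoc']
    rw [div_le_iff₀ (by positivity)]
    nlinarith [mul_pos hθ (pow_pos hcpos 4)]
  obtain ⟨Cfar, hfar⟩ := hfarStub ν hν u₀ hu hd hdiv ω hωpos
  obtain ⟨A₂, hA₂⟩ := hasDecay_fourierData hu hd (2 + 0)
  refine ⟨max Cfar A₂ + 36 * Real.pi / c * (1 * ω + 1⁻¹ * E₀), ?_⟩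
  intro T hT V hV hV0 t ht ξ
  have hslack : 0 ≤ 36 * Real.pi / c * (1 * ω + 1⁻¹ * E₀) := by positivity
  -- the data envelope
  have hdat : ∀ ζ : EuclideanSpace ℝ (Fin 3), ‖ζ‖ ^ 2 * ‖V 0 ζ‖ ≤ A₂ := fun ζ => by
    rw [hV0]; simpa using hA₂.pow_mul_norm_le (n := 2) (K := 0) ζ
  set Ens : ℝ → ℝ := fun r => ∫ ξ, ‖ξ‖ ^ 2 * ∑ l, ‖V r ξ l‖ ^ 2 with hEns
  have hEnsc : Continuous Ens := Leray.continuous_enstrophy hV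
  -- energy along `V` (componentwise and in the sup norm)
  have hEle : ∀ r ∈ Icc 0 T, ∫ η, ∑ l, ‖V r η l‖ ^ 2 ≤ E₀ := fun r hr => by
    have := Registered.energyIneq _ _ _ _ V hV r hr
    rw [hV0] at this; exact this
  have hEsup : ∀ r ∈ Icc 0 T, ∫ η, ‖V r η‖ ^ 2 ≤ E₀ := fun r hr => by
    refine le_trans ?_ (hEle r hr)
    exact integral_mono_of_nonneg (Eventually.of_forall fun η => sq_nonneg _) (integrable_sumSq hV r)
      (Eventually.of_forall fun η => norm_sq_le_sum_norm_sq (V r η))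
  have hEnssup : ∀ r, ∫ η, ‖η‖ ^ 2 * ‖V r η‖ ^ 2 ≤ Ens r := fun r =>
    integral_mono_of_nonneg (Eventually.of_forall fun η => by positivity) (integrable_pow_mul_sumSq hV 2 r)
      (Eventually.of_forall fun η => mul_le_mul_of_nonneg_left (norm_sq_le_sum_norm_sq (V r η)) (sq_nonneg _))
  -- the envelope from a time `r₀ ≤ t` with bounded envelope and `Ens r₀ ≤ ω`
  have from_r₀ : ∀ r₀ ∈ Icc 0 t, (∀ ζ : EuclideanSpace ℝ (Fin 3), ‖ζ‖ ^ 2 * ‖V r₀ ζ‖ ≤ max Cfar A₂) →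
      Ens r₀ ≤ ω → ‖ξ‖ ^ 2 * ‖V t ξ‖ ≤ max Cfar A₂ + 36 * Real.pi / c * (1 * ω + 1⁻¹ * E₀) := by
    intro r₀ hr₀ henv hEnsr₀
    have hr₀T : r₀ ≤ T := hr₀.2.trans ht.2
    -- Leray from `r₀`
    have hsmall : (∫ ξ, ∑ l, ‖V r₀ ξ l‖ ^ 2) * (∫ ξ, ‖ξ‖ ^ 2 * ∑ l, ‖V r₀ ξ l‖ ^ 2) ≤ θ * c ^ 4 := by
      calc (∫ ξ, ∑ l, ‖V r₀ ξ l‖ ^ 2) * (∫ ξ, ‖ξ‖ ^ 2 * ∑ l, ‖V r₀ ξ l‖ ^ 2) ≤ E₀ * ω :=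
            mul_le_mul (hEle r₀ ⟨hr₀.1, hr₀T⟩) hEnsr₀
              (integral_nonneg fun ξ => by positivity) hE₀0
        _ ≤ θ * c ^ 4 := hE₀ω
    have hEnsle : ∀ r ∈ Icc r₀ T, Ens r ≤ ω := fun r hr =>
      (hler c 4 0 T V hV r₀ ⟨hr₀.1, hr₀T⟩ hsmall r hr).trans hEnsr₀
    -- the translated solution from `r₀`
    have hW : IsFourierMild c 4 0 (T - r₀) (fun τ => V (τ + r₀)) :=
      Registered.rebase (hV.mono hr₀.1 hr₀T le_rfl)
    have hEW : ∀ τ ∈ Icc 0 (T - r₀), ∫ η, ‖(fun τ => V (τ + r₀)) τ η‖ ^ 2 ≤ E₀ := fun τ hτ =>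
      hEsup (τ + r₀) ⟨by linarith [hτ.1, hr₀.1], by linarith [hτ.2]⟩
    have hΩW : ∀ τ ∈ Icc 0 (T - r₀), ∫ η, ‖η‖ ^ 2 * ‖(fun τ => V (τ + r₀)) τ η‖ ^ 2 ≤ ω := fun τ hτ =>
      (hEnssup (τ + r₀)).trans (hEnsle (τ + r₀) ⟨by linarith [hτ.1], by linarith [hτ.2]⟩)
    have key := Registered.envelope_le_of_enstrophy hW one_pos hEW hΩW (t := t - r₀)
      ⟨by linarith [hr₀.2], by linarith [ht.2]⟩ ξ
    simp only [sub_add_cancel, zero_add] at key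
    linarith [henv ξ]
  by_cases hfarcase : ∀ r ∈ Icc 0 t, ω ≤ Ens r
  · -- far from Leray on all of `[0,t]`: the far stub
    have hhor : t ≤ (∫ ξ, ∑ l, ‖fourierData hu hd ξ l‖ ^ 2) / (2 * (4 * Real.pi ^ 2 * ν) * ω) := by
      have := far_horizon hV hωpos ht hfarcase
      rw [hV0] at this; exact this
    have := hfar T V hV hV0 t ht hhor hfarcase ξ
    linarith [le_max_left Cfar A₂]
  · -- the first time `r₀ ≤ t` at which `Ens ≤ ω`
    push Not at hfarcase
    obtain ⟨r₁, hr₁, hr₁ω⟩ := hfarcase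
    set S : Set ℝ := {r | r ∈ Icc 0 t ∧ Ens r ≤ ω} with hSdef
    have hSne : S.Nonempty := ⟨r₁, hr₁, hr₁ω.le⟩
    have hSbdd : BddBelow S := ⟨0, fun r hr => hr.1.1⟩
    have hSclosed : IsClosed S := isClosed_Icc.inter (isClosed_le hEnsc continuous_const)
    set r₀ : ℝ := sInf S with hr₀def
    have hr₀S : r₀ ∈ S := hSclosed.csInf_mem hSne hSbdd
    have hr₀ : r₀ ∈ Icc 0 t := hr₀S.1
    have hEnsr₀ : Ens r₀ ≤ ω := hr₀S.2
    have hbefore : ∀ r ∈ Ico 0 r₀, ω ≤ Ens r := by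
      intro r hr
      by_contra hlt
      push Not at hlt
      have hrS : r ∈ S := ⟨⟨hr.1, hr.2.le.trans hr₀.2⟩, hlt.le⟩
      exact absurd (csInf_le hSbdd hrS) (not_le.2 hr.2)
    -- the envelope at `r₀`
    have henv : ∀ ζ : EuclideanSpace ℝ (Fin 3), ‖ζ‖ ^ 2 * ‖V r₀ ζ‖ ≤ max Cfar A₂ := by
      intro ζ
      rcases eq_or_lt_of_le hr₀.1 with h0 | h0
      · rw [← h0]; exact (hdat ζ).trans (le_max_right _ _)
      · -- `Ens ≥ ω` on `[0, r₀)` hence on `[0, r₀]` by continuity: the far stub applies at `r₀`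
        have hall : ∀ r ∈ Icc 0 r₀, ω ≤ Ens r := by
          have hclosed : IsClosed {r | ω ≤ Ens r} := isClosed_le continuous_const hEnsc
          have hsub : Ico 0 r₀ ⊆ {r | ω ≤ Ens r} := fun r hr => hbefore r hr
          have := (closure_minimal hsub hclosed)
          rw [closure_Ico h0.ne] at this
          exact fun r hr => this hr
        have hr₀T : r₀ ∈ Icc 0 T := ⟨hr₀.1, hr₀.2.trans ht.2⟩
        have hhor : r₀ ≤ (∫ ξ, ∑ l, ‖fourierData hu hd ξ l‖ ^ 2) / (2 * (4 * Real.pi ^ 2 * ν) * ω) := by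
          have := far_horizon hV hωpos hr₀T hall
          rw [hV0] at this; exact this
        exact (hfar T V hV hV0 r₀ hr₀T hhor hall ζ).trans (le_max_left _ _)
    exact from_r₀ r₀ hr₀ henv hEnsr₀



/-- **The far stub follows from the crux** (so, given the classical stubs, `stub_farFromLeray ⇔ EnvelopeBound`):
at threshold `ω` take the horizon `T₀ := E₀/(2cω) + 1` in the crux and restrict longer solutions to `[0,T₀]`. -/
theorem farFromLeray_of_envelopeBound (hA : Summit.NavierStokesRegularity.NavierStokesRegularity.Theses.FrozenSignCascade.EnvelopeBound) :
    ∀ ν : ℝ, 0 < ν →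
      ∀ (u₀ : EuclideanSpace ℝ (Fin 3) → EuclideanSpace ℝ (Fin 3)) (hu : ContDiff ℝ (⊤ : ℕ∞) u₀)
        (hd : Literature.Analysis.FluidPDE.HasRapidSpatialDecay u₀),
        Literature.Analysis.FluidPDE.NSWave0.IsDivFree u₀ →
      ∀ ω : ℝ, 0 < ω → ∃ C : ℝ, ∀ T : ℝ, ∀ V : ℝ → EuclideanSpace ℝ (Fin 3) → Fin 3 → ℂ,
        Literature.Analysis.FluidPDE.FourierNS.IsFourierMild (4 * Real.pi ^ 2 * ν) 4 0 T V →
        V 0 = Literature.Analysis.FluidPDE.FourierNS.fourierData hu hd →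
        ∀ t ∈ Set.Icc 0 T,
          t ≤ (∫ ξ, ∑ l, ‖Literature.Analysis.FluidPDE.FourierNS.fourierData hu hd ξ l‖ ^ 2) /
            (2 * (4 * Real.pi ^ 2 * ν) * ω) →
          (∀ r ∈ Set.Icc 0 t, ω ≤ ∫ ξ, ‖ξ‖ ^ 2 * ∑ l, ‖V r ξ l‖ ^ 2) →
          ∀ ξ : EuclideanSpace ℝ (Fin 3), ‖ξ‖ ^ 2 * ‖V t ξ‖ ≤ C := by
  intro ν hν u₀ hu hd hdiv ω hω
  set T₀ : ℝ := (∫ ξ, ∑ l, ‖fourierData hu hd ξ l‖ ^ 2) / (2 * (4 * Real.pi ^ 2 * ν) * ω) + 1 with hT₀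
  have hE₀0 : 0 ≤ ∫ ξ, ∑ l, ‖fourierData hu hd ξ l‖ ^ 2 :=
    integral_nonneg fun ξ => Finset.sum_nonneg fun l _ => sq_nonneg _
  have hT₀pos : 0 < T₀ := by positivity
  obtain ⟨C, hC⟩ := hA ν hν u₀ hu hd hdiv T₀ hT₀pos
  refine ⟨C, fun T V hV hV0 t ht hthor _ ξ => ?_⟩
  rcases le_total T T₀ with hT | hT
  · exact hC T hT V hV hV0 t ht ξ
  · have htT₀ : t ≤ T₀ := by linarith
    exact hC T₀ le_rfl V (hV.mono le_rfl hT₀pos.le hT) hV0 t ⟨ht.1, htT₀⟩ ξ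

/-- **The Leray-class regime of the crux (NEW provable regime).** There is an absolute `θ > 0` such that for
every `ν > 0` and every Clay datum whose Fourier datum `a` is LERAY-SMALL in the scale-invariant sense
`(∫∑ₗ‖aₗ‖²)·(∫‖ξ‖²∑ₗ‖aₗ‖²) ≤ θ (4π²ν)⁴` (i.e. `‖u₀‖₂²‖∇u₀‖₂² ≲ ν⁴`, Leray 1934), the conclusion of
`EnvelopeBound` holds for that datum at EVERY horizon, with a horizon-independent constant: Leray's lemma from
time `0` keeps the enstrophy below its initial value along every mild solution, and energy × enstrophy controls
the critical envelope (`Registered.envelope_le_of_enstrophy`). Complements the small-`PM²` regime (p150705). -/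
theorem envelope_lerayClass :
    ∃ θ : ℝ, 0 < θ ∧ ∀ ν : ℝ, 0 < ν →
      ∀ (u₀ : EuclideanSpace ℝ (Fin 3) → EuclideanSpace ℝ (Fin 3)) (hu : ContDiff ℝ (⊤ : ℕ∞) u₀)
        (hd : Literature.Analysis.FluidPDE.HasRapidSpatialDecay u₀),
        Literature.Analysis.FluidPDE.NSWave0.IsDivFree u₀ →
        (∫ ξ, ∑ l, ‖Literature.Analysis.FluidPDE.FourierNS.fourierData hu hd ξ l‖ ^ 2) *
          (∫ ξ, ‖ξ‖ ^ 2 * ∑ l, ‖Literature.Analysis.FluidPDE.FourierNS.fourierData hu hd ξ l‖ ^ 2) ≤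
            θ * (4 * Real.pi ^ 2 * ν) ^ 4 →
        ∃ C : ℝ, ∀ T : ℝ, ∀ V : ℝ → EuclideanSpace ℝ (Fin 3) → Fin 3 → ℂ,
          Literature.Analysis.FluidPDE.FourierNS.IsFourierMild (4 * Real.pi ^ 2 * ν) 4 0 T V →
          V 0 = Literature.Analysis.FluidPDE.FourierNS.fourierData hu hd →
          ∀ t ∈ Set.Icc 0 T, ∀ ξ : EuclideanSpace ℝ (Fin 3), ‖ξ‖ ^ 2 * ‖V t ξ‖ ≤ C := by
  obtain ⟨θ, hθ, hler⟩ := leray_threshold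
  refine ⟨θ, hθ, ?_⟩
  intro ν hν u₀ hu hd hdiv hsmall
  set c : ℝ := 4 * Real.pi ^ 2 * ν with hc
  have hcpos : 0 < c := by positivity
  set a : EuclideanSpace ℝ (Fin 3) → Fin 3 → ℂ := fourierData hu hd with ha
  set E₀ : ℝ := ∫ ξ, ∑ l, ‖a ξ l‖ ^ 2 with hE₀
  set Ω₀ : ℝ := ∫ ξ, ‖ξ‖ ^ 2 * ∑ l, ‖a ξ l‖ ^ 2 with hΩ₀
  obtain ⟨A₂, hA₂⟩ := hasDecay_fourierData hu hd (2 + 0)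
  refine ⟨A₂ + 36 * Real.pi / c * (1 * Ω₀ + 1⁻¹ * E₀), ?_⟩
  intro T V hV hV0 t ht ξ
  have hEle : ∀ r ∈ Icc 0 T, ∫ η, ‖V r η‖ ^ 2 ≤ E₀ := fun r hr => by
    have h1 := Registered.energyIneq _ _ _ _ V hV r hr
    rw [hV0] at h1
    exact le_trans (integral_mono_of_nonneg (Eventually.of_forall fun η => sq_nonneg _)
      (integrable_sumSq hV r) (Eventually.of_forall fun η => norm_sq_le_sum_norm_sq (V r η))) h1
  have hsmall' : (∫ ξ, ∑ l, ‖V 0 ξ l‖ ^ 2) * (∫ ξ, ‖ξ‖ ^ 2 * ∑ l, ‖V 0 ξ l‖ ^ 2) ≤ θ * c ^ 4 := by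
    rw [hV0]; exact hsmall
  have hEnsle : ∀ r ∈ Icc 0 T, ∫ η, ‖η‖ ^ 2 * ‖V r η‖ ^ 2 ≤ Ω₀ := fun r hr => by
    have h1 := hler c 4 0 T V hV 0 ⟨le_rfl, hV.le⟩ hsmall' r hr
    rw [hV0] at h1
    exact le_trans (integral_mono_of_nonneg (Eventually.of_forall fun η => by positivity)
      (integrable_pow_mul_sumSq hV 2 r) (Eventually.of_forall fun η =>
        mul_le_mul_of_nonneg_left (norm_sq_le_sum_norm_sq (V r η)) (sq_nonneg _))) h1
  have key := Registered.envelope_le_of_enstrophy hV one_pos hEle hEnsle ht ξ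
  have hdat : ‖ξ‖ ^ 2 * ‖V 0 ξ‖ ≤ A₂ := by
    rw [hV0]; simpa using hA₂.pow_mul_norm_le (n := 2) (K := 0) ξ
  linarith

/-- **The crux is EQUIVALENT to far-from-Leray control** (its r3 open stub): the crux lives on the bounded
Leray window `[0, E₀/(2cω)]`. -/
theorem envelopeBound_iff_farFromLeray :
    Summit.NavierStokesRegularity.NavierStokesRegularity.Theses.FrozenSignCascade.EnvelopeBound ↔
    (∀ ν : ℝ, 0 < ν →
      ∀ (u₀ : EuclideanSpace ℝ (Fin 3) → EuclideanSpace ℝ (Fin 3)) (hu : ContDiff ℝ (⊤ : ℕ∞) u₀)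
        (hd : Literature.Analysis.FluidPDE.HasRapidSpatialDecay u₀),
        Literature.Analysis.FluidPDE.NSWave0.IsDivFree u₀ →
      ∀ ω : ℝ, 0 < ω → ∃ C : ℝ, ∀ T : ℝ, ∀ V : ℝ → EuclideanSpace ℝ (Fin 3) → Fin 3 → ℂ,
        Literature.Analysis.FluidPDE.FourierNS.IsFourierMild (4 * Real.pi ^ 2 * ν) 4 0 T V →
        V 0 = Literature.Analysis.FluidPDE.FourierNS.fourierData hu hd →
        ∀ t ∈ Set.Icc 0 T,
          t ≤ (∫ ξ, ∑ l, ‖Literature.Analysis.FluidPDE.FourierNS.fourierData hu hd ξ l‖ ^ 2) /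
            (2 * (4 * Real.pi ^ 2 * ν) * ω) →
          (∀ r ∈ Set.Icc 0 t, ω ≤ ∫ ξ, ‖ξ‖ ^ 2 * ∑ l, ‖V r ξ l‖ ^ 2) →
          ∀ ξ : EuclideanSpace ℝ (Fin 3), ‖ξ‖ ^ 2 * ‖V t ξ‖ ≤ C) :=
  ⟨farFromLeray_of_envelopeBound, envelopeBound_of_farFromLeray⟩

end Summit.NavierStokesRegularity.NavierStokesRegularity.Theorems.EnvelopeBound.Leray

end
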